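import Summits.AnomalousDissipation.AnomalousDissipation.Theses.TaylorCertificates
import Summits.AnomalousDissipation.AnomalousDissipation.Theorems.TaylorCertificatesSteadyStatesLoudBoundedStubResidualTransfer
import Summits.AnomalousDissipation.AnomalousDissipation.Theorems.TaylorCertificatesSteadyStatesLoudBoundedStubCompactnessSplit
import Summits.AnomalousDissipation.AnomalousDissipation.Theorems.TaylorCertificatesSteadyStatesLoudBoundedStubTruncationResidual
import Summits.AnomalousDissipation.AnomalousDissipation.Theorems.TaylorCertificatesSteadyStatesLoudBoundedStubDodgerAssembly
import Summits.AnomalousDissipation.AnomalousDissipation.Theorems.EnsembleCeiling.Negative.BeltramiFat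
import Summits.AnomalousDissipation.AnomalousDissipation.Theorems.EnsembleCeiling.Negative.DiracAtoms
import Literature.Analysis.FluidPDE.StatisticalSolution
import HarnessLib.Audit

/-! TTRL-lite variant V2195 of stmt-AnomalousDissipation-13038 -/

-- `Summit.<Summit>.<Problem>` is the tree's mandated summit-side namespace (CONVENTIONS §2); for this
-- single-conjunct summit the two coincide, so the duplicate is deliberate.
set_option linter.dupNamespace false

namespace Summit.AnomalousDissipation.AnomalousDissipation.Theorems

open MeasureTheory Filter Topology UnitAddTorus Matrix
open scoped InnerProductSpace ENNReal ComplexConjugate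
open Literature.Analysis.FunctionSpaces Literature.Analysis.FluidPDE
open Summit.AnomalousDissipation.AnomalousDissipation.Theses.TaylorCertificates
open Summit.AnomalousDissipation.AnomalousDissipation.Theorems.TaylorCertificatePair.Negative
open Summit.AnomalousDissipation.AnomalousDissipation.Theorems.EnsembleCeiling.Negative

/-- **Variant V2195 of `stub_f123NoOnsagerDodgerLevel3` (hypothesis 0 dropped) is FALSE.**
Without the admissibility / residual hypothesis tying `R` to `u`, take `R := 0` (both `Tendsto`
hypotheses become trivial) and `u n := W_{n+1}`, the shear wiggles of
`SteadyStatesLoudBounded.DodgerAssembly.dodgerAssembly_partA` with `‖∇W_M‖₂² = 4π² M²`: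
the enstrophy `4π² (n+1)²` diverges, so no level `B` is visited infinitely often. [folklore] -/
theorem stub_f123NoOnsagerDodgerLevel3_var2195_false :
    ¬ (∀ (u : ℕ → UnitAddTorus (Fin 3) → EuclideanSpace ℝ (Fin 3)) (R : ℕ → ℝ),
        Tendsto R atTop (𝓝 0) →
        Tendsto (fun n => R n * Real.sqrt (Torus.gradNormSq (u n))) atTop (𝓝 0) →
        ∃ B : ℝ, ∀ N : ℕ, ∃ n : ℕ, N ≤ n ∧ Torus.gradNormSq (u n) ≤ B) := by
  intro h
  have hWex : ∀ n : ℕ, ∃ W : UnitAddTorus (Fin 3) → EuclideanSpace ℝ (Fin 3),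
      Torus.gradNormSq W = 4 * Real.pi ^ 2 * ((n + 1 : ℕ) : ℝ) ^ 2 := fun n => by
    obtain ⟨W, -, -, -, -, -, -, hG, -⟩ :=
      SteadyStatesLoudBounded.DodgerAssembly.dodgerAssembly_partA (n + 1) (Nat.succ_ne_zero n)
    exact ⟨W, hG⟩
  choose W hW using hWex
  obtain ⟨B, hB⟩ := h W (fun _ => 0) tendsto_const_nhds (by simp)
  obtain ⟨N, hN⟩ := exists_nat_gt B
  obtain ⟨n, hn, hle⟩ := hB N
  rw [hW n] at hle
  have hπ : 1 ≤ 4 * Real.pi ^ 2 := by nlinarith [Real.pi_gt_three]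
  have hn' : (N : ℝ) ≤ n := by exact_mod_cast hn
  have hcast : ((n + 1 : ℕ) : ℝ) = (n : ℝ) + 1 := by push_cast; ring
  rw [hcast] at hle
  nlinarith [Nat.cast_nonneg (α := ℝ) n]

end Summit.AnomalousDissipation.AnomalousDissipation.Theorems
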